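import Mathlib
import HarnessLib

/-!
# Route `KLProgramme` — crux K3 ENGINE (stmt-HubbardSuperconductivity-20437 `KLRegimeEngineV17F2`), stub (b) v2, THE LEVELS PACKAGE (ℓ):
# instantiation (I1), «(I1)-LEV-GRADED-UNITS» — the e*-weights qualify for the graded rows
# (UNITS-MAP (p4 g17) §(1): `2e*(F) = min(F−1, 4)` keyed on powers of `√2`; cell gate-hubbard-kl, seat hubbard-kl-k3c2-p3 g12)

The graded dictionary (…TowerDoorToKitGraded, p651090) and the graded model rows (…TowerBlockIncrLevKitGraded, p651584/p651834) take the level weights as a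
binder `ω : ℕ → ℝ` with four hypotheses: `0 ≤ ω c`, `ω 0 ≤ 1`, `ω a·ω b ≤ ω (a+b)`, `ω (c+1) ≤ ω c`, plus a re-truncation depth `Kt` with `(1/2)^{Kt} ≤ ω(2q+1)`.
Here: the e*-weights of LEV-UNITS-NOTE / UNITS-MAP, `ω c := ((√2)^{min c 4 · J})⁻¹` (level `c+1`, `2e*(c+1) = min c 4`, family index `J`), satisfy all of
them, and `Kt := 2J` serves every level.  Pure real arithmetic; nothing asserts (ℓ), any stub, K3 or superconductivity.
References: BGM 2006 Lemma 2.5 (2.98) (the level gain exponent) [cite: BenfattoGiulianiMastropietro2006].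
-/

noncomputable section

namespace Summit.HubbardSuperconductivity.HubbardSuperconductivity.Theorems.EngineV8

set_option linter.dupNamespace false -- summit = problem name (single-conjunct summit), D-0017

/-! ## The e*-weights `ω c = ((√2)^{min c 4 · J})⁻¹` -/

/-- The e*-weight is nonnegative. -/
theorem levWeight_nonneg (J c : ℕ) : 0 ≤ ((Real.sqrt 2) ^ (min c 4 * J))⁻¹ := by positivity

/-- The e*-weight of level `0` is `1`. -/
theorem levWeight_zero (J : ℕ) : ((Real.sqrt 2) ^ (min 0 4 * J))⁻¹ = 1 := by simp

/-- **Supermultiplicativity of the e*-weights** (`min (a+b) 4 ≤ min a 4 + min b 4` — LEV-UNITS-NOTE §1's consistency `e*(a+1)+e*(b+1) ≥ e*(a+b+1)`). -/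
theorem levWeight_supermul (J a b : ℕ) :
    ((Real.sqrt 2) ^ (min a 4 * J))⁻¹ * ((Real.sqrt 2) ^ (min b 4 * J))⁻¹ ≤ ((Real.sqrt 2) ^ (min (a + b) 4 * J))⁻¹ := by
  rw [← mul_inv, ← pow_add]
  have h0 : 0 < Real.sqrt 2 ^ (min (a + b) 4 * J) := by positivity
  refine (inv_le_inv₀ (by positivity) h0).2 (pow_le_pow_right₀ (Real.one_le_sqrt.2 (by norm_num)) ?_)
  have : min (a + b) 4 ≤ min a 4 + min b 4 := by omega
  nlinarith [Nat.zero_le J, this]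

/-- **The e*-weights are antitone in the level.** -/
theorem levWeight_anti (J c : ℕ) : ((Real.sqrt 2) ^ (min (c + 1) 4 * J))⁻¹ ≤ ((Real.sqrt 2) ^ (min c 4 * J))⁻¹ := by
  have h0 : 0 < Real.sqrt 2 ^ (min c 4 * J) := by positivity
  refine (inv_le_inv₀ (by positivity) h0).2 (pow_le_pow_right₀ (Real.one_le_sqrt.2 (by norm_num)) ?_)
  exact Nat.mul_le_mul_right _ (by omega)

/-- **The re-truncation depth `Kt := 2J` serves every level**: `(1/2)^{2J} ≤ ((√2)^{min c 4 · J})⁻¹`. -/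
theorem half_pow_le_levWeight (J c : ℕ) : (1 / 2 : ℝ) ^ (2 * J) ≤ ((Real.sqrt 2) ^ (min c 4 * J))⁻¹ := by
  have h2 : Real.sqrt 2 ^ 2 = 2 := Real.sq_sqrt (by norm_num)
  have h4 : Real.sqrt 2 ^ (4 * J) = 2 ^ (2 * J) := by
    rw [show 4 * J = 2 * (2 * J) by ring, pow_mul, h2]
  have h0 : 0 < Real.sqrt 2 ^ (min c 4 * J) := by positivity
  calc (1 / 2 : ℝ) ^ (2 * J) = (Real.sqrt 2 ^ (4 * J))⁻¹ := by rw [h4, one_div, inv_pow]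
    _ ≤ ((Real.sqrt 2) ^ (min c 4 * J))⁻¹ :=
        (inv_le_inv₀ (by positivity) h0).2 (pow_le_pow_right₀ (Real.one_le_sqrt.2 (by norm_num)) (Nat.mul_le_mul_right _ (min_le_right _ _)))

end Summit.HubbardSuperconductivity.HubbardSuperconductivity.Theorems.EngineV8

end
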